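import Literature.NumberTheory.Sieve.AsymptoticSieveForPrimesTheorem2Counting
import HarnessLib

/-!
# Asymptotic sieve for primes, Theorem 2: the error functionals `RS`, `ES`, `TG` of the reduction `a ↦ μ²a`

Topic `Literature/NumberTheory/Sieve` (trunk T-SIEVE), sequel of `…Theorem2Counting`. Source:
J. Friedlander, H. Iwaniec, *Asymptotic sieve for primes*, Ann. of Math. 148 (1998) 1041–1065
[FriedlanderIwaniecASP1998] (= arXiv:math/9811186), §9 pp. 1061–1062: "(9.7) … We shall derive this
from (R₃) … `R(t,D) ≪ E log x`, where `E = ∑♭_ν ∑♭_{d≤D} |r_{[ν²,d]}(t)|` … By (R′₃) … the error terms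
with `ν ≤ L` and `d ≤ D` contribute `E₁ ≪ A(x)L⁻¹(log x)^{2^{17}}`. From the remaining terms we get
`E₂ ≤ ∑♭_{ν>L} ∑♭_{d≤x} (A_{[ν²,d]}(x) + g([ν²,d])A(x)) = E₂₁ + E₂₂ + O(A(x)(log x)L⁻¹(log L)^B)` …
`E₂₁ ≤ (∑ a_n²)^{1/2} (…)^{1/2}` … `E₂₂² ≤ (∑♭_{L<ν≤L√D} A_{ν²}(x))(∑ a_n τ(n)³) = S₁S₂`."

This file bounds, for a GENERAL sifted sequence and at a fixed `x`, the three error functionals of the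
pointwise decomposition of `r̃_d` (`…Theorem2Identities`: `RS`, `ES`, `TG`, truncation at `ℓ_L ≤ Λ`),
summed over the squarefree `d ≤ D₀`, by quantities that the hypotheses (2.2), (2.7)–(2.9) of
[FriedlanderIwaniecAnnals1998] Proposition 2.1 control (the sequel `…Theorem2` inserts those). The
weights are powers of `2^{ω}` throughout (cf. `…Theorem2Counting`), and Cauchy–Schwarz replaces FI's
divisor-function bookkeeping:

* `RS` (FI's `E₁`): `∑_d RS_d(t) ≤ ∑_{b ≤ M cubefree} 2^{ω(b)} |r_b(t)|` (`D₀Λ² ≤ M`;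
  `sum_sum_small_abs_remainder_le_weighted`), and the weighted cubefree remainder sum obeys
  `(∑_b 2^{ω(b)}|r_b(t)|)² ≤ (∑_b 4^{ω(b)}(A_b(x) + g(b)A(x))) · ∑_b |r_b(t)|`
  (`sq_sum_two_pow_abs_remainder_le`), with `∑_b 4^{ω(b)} A_b(x) ≤ ∑_n a_n 2^{4ω(n)}`
  (`sum_four_pow_mul_congrSum_le`) — a moment of `…Theorem2Counting` — and `∑_b 4^{ω(b)} g(b)` an
  Euler product (`sum_cubefree_pow_mul_density_le` there);
* `ES` (FI's `E₂₁ + E₂₂`): `∑_d ES_d(t) ≤ ∑_{Λ<ℓ≤√t sqfree} W_t(ℓ²)`,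
  `W_t(m) = ∑_{n≤t, m∣n} a_n 2^{ω(n)}` (`sum_sum_big_congrSum_lcm_le`); on `ℓ > Λ₁`,
  `(∑_ℓ W_t(ℓ²))² ≤ (∑_{n≤t} a_n²) · (N V² / Λ₁)`-type bound through the divisor sums
  `V = ∑_{m≤X} τ(m)³/m` (`sq_sum_weighted_large_le`); on `Λ < ℓ ≤ Λ₁`,
  `(∑_ℓ W_x(ℓ²))² ≤ S₁ · ∑_n a_n 2^{3ω(n)}`, `S₁ = ∑_{Λ<ℓ≤Λ₁ sqfree} A_{ℓ²}(x)` (`sq_sum_weighted_mid_le`),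
  and `S₁ ≤ A(x) Λ^{-3/4} e^{K C} + ∑_{b ≤ M cubefree} |r_b(x)|` by Rankin's trick with exponent `3/4`
  and the level hypothesis (`sum_mid_congrSum_sq_le_rankin`);
* `TG`: `∑_d TG_d ≤ (∑_{ℓ_L>Λ} 2^{|L|} ∏_{p∈L} g(p²)) ∑_{d≤D₀ sqfree} g(d)` and
  `∑_{ℓ_L > Λ} 2^{|L|} ∏ g(p²) ≤ Λ^{-3/4} exp(2K ∑_n n^{-5/4})` (`sum_sum_big_density_lcm_le`,
  `sum_big_two_pow_mul_prod_le_rankin`).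

## References

* J. Friedlander, H. Iwaniec, *Asymptotic sieve for primes*, Ann. of Math. 148 (1998), 1041–1065,
  §9 pp. 1061–1062 (`E₁`, `E₂₁`, `E₂₂`, `S₁`, `S₂`). [cite: FriedlanderIwaniecASP1998, §9 pp. 1061-1062]

## Mathlib / tree search

Tree (patterns generalised from `FriedlanderIwaniecPrimesSquarefreeProofs`, Part D, which treats FI's
specific sequence with power savings): `sum_sum_small_abs_remainder_le`, `sum_congrSum_lcm_le`,
`sum_big_congrSum_sq_le`, `sum_fiDensity_lcm_sq_le`, `sum_big_two_pow_mul_prod_le`; reused: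
`card_fibre_lcm_le_two_pow`, `card_filter_dvd_le_two_pow`, `card_filter_dvd_le_three_pow`
(`…Theorem2Counting`), `isCubefree_lcm_sq`, `lcm_sq_pos_le`, `squarefree_prod_of_primes`,
`two_pow_card_primeFactors_le_sigma` (`…SquarefreeProofs`), `SieveSequence.sum_mul_congrSum_eq`,
`sum_squarefree_prod_primeFactors_le`, `prod_one_add_le_exp_sum` (`…Reduction`). Mathlib:
`Finset.sum_sq_le_sum_mul_sum_of_sq_le_mul` (Cauchy–Schwarz), `Real.summable_nat_rpow`.
`lean search 'weighted_large|weighted_mid|le_rankin'`: nothing before this file.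
-/

noncomputable section

open Filter Finset Real
open scoped ArithmeticFunction.sigma

namespace Literature.NumberTheory.Sieve

open FriedlanderIwaniecPrimesSquarefree FriedlanderIwaniecPrimes

namespace SieveSequence

variable (A : SieveSequence)

/-! ### `RS`: regrouping by the cubefree modulus `b = lcm(d, ℓ_L²)` -/

/-- **`RS` summed over `d`** (FI's `E₁`, p. 1061, with the representation count `2^{ω(b)}`): for
`D₀Λ² ≤ M`, `∑_{d ≤ D₀ sqfree} ∑_{L ⊆ T, ℓ_L ≤ Λ} |r_{lcm(d,ℓ_L²)}(t)| ≤ ∑_{b ≤ M cubefree} 2^{ω(b)} |r_b(t)|`.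
[cite: FriedlanderIwaniecASP1998, §9 p. 1061] -/
theorem sum_sum_small_abs_remainder_le_weighted {T : Finset ℕ} (hT : ∀ p ∈ T, p.Prime) (t : ℝ)
    {D₀ Λ M : ℕ} (hM : D₀ * Λ ^ 2 ≤ M) :
    ∑ d ∈ (Icc 1 D₀).filter Squarefree, ∑ L ∈ T.powerset with (∏ p ∈ L, p) ≤ Λ,
        |A.remainder (Nat.lcm d ((∏ p ∈ L, p) ^ 2)) t| ≤
      ∑ b ∈ (Icc 1 M).filter IsCubefree, (2 : ℝ) ^ b.primeFactors.card * |A.remainder b t| := by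
  set 𝒟 := (Icc 1 D₀).filter Squarefree with h𝒟
  set P := T.powerset.filter (fun L => (∏ p ∈ L, p) ≤ Λ) with hP
  set m : ℕ × Finset ℕ → ℕ := fun q => Nat.lcm q.1 ((∏ p ∈ q.2, p) ^ 2) with hm
  set f : ℕ → ℝ := fun b => |A.remainder b t| with hf
  have hf0 : ∀ b, 0 ≤ f b := fun b => abs_nonneg _
  have h𝒟sq : ∀ d ∈ 𝒟, Squarefree d := fun d hd => (Finset.mem_filter.mp hd).2
  have hPp : ∀ L ∈ P, ∀ p ∈ L, p.Prime := fun L hL p hp =>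
    hT p (Finset.mem_powerset.mp (Finset.mem_filter.mp hL).1 hp)
  rw [← Finset.sum_product (s := 𝒟) (t := P) (f := fun q => f (m q))]
  rw [Finset.sum_comp f m]
  have hq : ∀ q ∈ 𝒟 ×ˢ P, Squarefree q.1 ∧ 1 ≤ q.1 ∧ q.1 ≤ D₀ ∧ (∀ p ∈ q.2, p.Prime) ∧
      (∏ p ∈ q.2, p) ≤ Λ := by
    intro q hq
    obtain ⟨h1, h2⟩ := Finset.mem_product.mp hq
    have h1' := Finset.mem_filter.mp h1
    have h2' := Finset.mem_filter.mp h2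
    exact ⟨h1'.2, (Finset.mem_Icc.mp h1'.1).1, (Finset.mem_Icc.mp h1'.1).2,
      fun p hp => hT p (Finset.mem_powerset.mp h2'.1 hp), h2'.2⟩
  have himg : (𝒟 ×ˢ P).image m ⊆ (Icc 1 M).filter IsCubefree := by
    intro b hb
    obtain ⟨q, hq', rfl⟩ := Finset.mem_image.mp hb
    obtain ⟨hsq, h1, hD, hLp, hΛ⟩ := hq q hq'
    have hb := lcm_sq_pos_le (by omega : q.1 ≠ 0) hLp
    refine Finset.mem_filter.mpr ⟨Finset.mem_Icc.mpr ⟨hb.1, hb.2.trans ?_⟩, isCubefree_lcm_sq hsq hLp⟩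
    calc q.1 * (∏ p ∈ q.2, p) ^ 2 ≤ D₀ * Λ ^ 2 := Nat.mul_le_mul hD (Nat.pow_le_pow_left hΛ 2)
      _ ≤ M := hM
  have hfib : ∀ b ∈ (𝒟 ×ˢ P).image m,
      ((#{q ∈ 𝒟 ×ˢ P | m q = b} : ℕ) : ℝ) ≤ (2 : ℝ) ^ b.primeFactors.card := by
    intro b hb
    have hb' := Finset.mem_filter.mp (himg hb)
    have hb0 : b ≠ 0 := by have := (Finset.mem_Icc.mp hb'.1).1; omega
    exact_mod_cast card_fibre_lcm_le_two_pow 𝒟 h𝒟sq P hPp hb0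
  calc ∑ b ∈ (𝒟 ×ˢ P).image m, #{q ∈ 𝒟 ×ˢ P | m q = b} • f b
      ≤ ∑ b ∈ (𝒟 ×ˢ P).image m, (2 : ℝ) ^ b.primeFactors.card * f b := by
        refine Finset.sum_le_sum fun b hb => ?_
        rw [nsmul_eq_mul]
        exact mul_le_mul_of_nonneg_right (hfib b hb) (hf0 b)
    _ ≤ ∑ b ∈ (Icc 1 M).filter IsCubefree, (2 : ℝ) ^ b.primeFactors.card * f b :=
        Finset.sum_le_sum_of_subset_of_nonneg himg fun b _ _ => mul_nonneg (by positivity) (hf0 b)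

/-- **Cauchy–Schwarz for the weighted cubefree remainder sum**:
`(∑_b 2^{ω(b)} |r_b(t)|)² ≤ (∑_b 4^{ω(b)} |r_b(t)|) · ∑_b |r_b(t)|`. [folklore] -/
theorem sq_sum_two_pow_abs_remainder_le (B : Finset ℕ) (t : ℝ) :
    (∑ b ∈ B, (2 : ℝ) ^ b.primeFactors.card * |A.remainder b t|) ^ 2 ≤
      (∑ b ∈ B, (4 : ℝ) ^ b.primeFactors.card * |A.remainder b t|) * ∑ b ∈ B, |A.remainder b t| := by
  refine Finset.sum_sq_le_sum_mul_sum_of_sq_le_mul B (fun b _ => by positivity)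
    (fun b _ => abs_nonneg _) fun b _ => le_of_eq ?_
  rw [mul_pow, ← pow_mul, show (4 : ℝ) = 2 ^ 2 by norm_num, ← pow_mul]
  ring

/-- `|r_b(t)| ≤ A_b(x) + g(b) A_1(x)` for cubefree `b` and `t ≤ x` (size normalised by `size_eq`,
`g(b) ≥ 0` by (2.4), `A_b` non-decreasing). [folklore] -/
theorem abs_remainder_le_congrSum_add (hsize : ∀ t, A.size t = A.congrSum 1 t)
    (h24 : ∀ p : ℕ, p.Prime → 0 ≤ A.density (p ^ 2) ∧ A.density (p ^ 2) ≤ A.density p ∧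
      A.density p < 1)
    {b : ℕ} (hb : IsCubefree b) {t x : ℝ} (htx : t ≤ x) :
    |A.remainder b t| ≤ A.congrSum b x + A.density b * A.congrSum 1 x := by
  have hg : 0 ≤ A.density b := density_nonneg_of_isCubefree A.density_mult h24 hb
  rw [SieveSequence.remainder, hsize t]
  refine (abs_sub _ _).trans (add_le_add ?_ ?_)
  · rw [abs_of_nonneg (A.congrSum_nonneg b t)]; exact A.congrSum_mono b htx
  · rw [abs_of_nonneg (mul_nonneg hg (A.congrSum_nonneg 1 t))]
    exact mul_le_mul_of_nonneg_left (A.congrSum_mono 1 htx) hg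

/-- `∑_{b ∈ ℬ} 4^{ω(b)} A_b(x) ≤ ∑_{n ≤ x} a_n 2^{4ω(n)}` for a set `ℬ` of cubefree numbers
(`#{b ∈ ℬ : b ∣ n} ≤ 3^{ω(n)}` and `4^{ω(b)} ≤ 4^{ω(n)}`). [folklore] -/
theorem sum_four_pow_mul_congrSum_le (ℬ : Finset ℕ) (hℬ : ∀ b ∈ ℬ, IsCubefree b) (x : ℝ) :
    ∑ b ∈ ℬ, (4 : ℝ) ^ b.primeFactors.card * A.congrSum b x ≤
      ∑ n ∈ Ioc 0 ⌊x⌋₊, A.a n * (2 : ℝ) ^ (4 * n.primeFactors.card) := by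
  rw [A.sum_mul_congrSum_eq]
  refine Finset.sum_le_sum fun n hn => mul_le_mul_of_nonneg_left ?_ (A.a_nonneg n)
  have hn0 : n ≠ 0 := (Finset.mem_Ioc.mp hn).1.ne'
  calc ∑ b ∈ ℬ.filter (· ∣ n), (4 : ℝ) ^ b.primeFactors.card
      ≤ ∑ b ∈ ℬ.filter (· ∣ n), (4 : ℝ) ^ n.primeFactors.card := by
        refine Finset.sum_le_sum fun b hb => pow_le_pow_right₀ (by norm_num) ?_
        exact Finset.card_le_card (Nat.primeFactors_mono (Finset.mem_filter.mp hb).2 hn0)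
    _ = #(ℬ.filter (· ∣ n)) * (4 : ℝ) ^ n.primeFactors.card := by
        rw [Finset.sum_const, nsmul_eq_mul]
    _ ≤ (3 : ℝ) ^ n.primeFactors.card * (4 : ℝ) ^ n.primeFactors.card := by
        refine mul_le_mul_of_nonneg_right ?_ (by positivity)
        exact_mod_cast card_filter_dvd_le_three_pow ℬ hℬ hn0
    _ ≤ (2 : ℝ) ^ (4 * n.primeFactors.card) := by
        rw [← mul_pow, pow_mul]; norm_num
        exact pow_le_pow_left₀ (by norm_num) (by norm_num) _

/-- `∑_{b ∈ ℬ} 4^{ω(b)} |r_b(t)| ≤ ∑_{n≤x} a_n 2^{4ω(n)} + A_1(x) ∑_{b ∈ ℬ} 4^{ω(b)} g(b)` for cubefree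
`b ∈ ℬ` and `t ≤ x`. [folklore] -/
theorem sum_four_pow_abs_remainder_le (hsize : ∀ t, A.size t = A.congrSum 1 t)
    (h24 : ∀ p : ℕ, p.Prime → 0 ≤ A.density (p ^ 2) ∧ A.density (p ^ 2) ≤ A.density p ∧
      A.density p < 1)
    (ℬ : Finset ℕ) (hℬ : ∀ b ∈ ℬ, IsCubefree b) {t x : ℝ} (htx : t ≤ x) :
    ∑ b ∈ ℬ, (4 : ℝ) ^ b.primeFactors.card * |A.remainder b t| ≤
      ∑ n ∈ Ioc 0 ⌊x⌋₊, A.a n * (2 : ℝ) ^ (4 * n.primeFactors.card) +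
        A.congrSum 1 x * ∑ b ∈ ℬ, (4 : ℝ) ^ b.primeFactors.card * A.density b := by
  calc ∑ b ∈ ℬ, (4 : ℝ) ^ b.primeFactors.card * |A.remainder b t|
      ≤ ∑ b ∈ ℬ, (4 : ℝ) ^ b.primeFactors.card * (A.congrSum b x + A.density b * A.congrSum 1 x) :=
        Finset.sum_le_sum fun b hb => mul_le_mul_of_nonneg_left
          (A.abs_remainder_le_congrSum_add hsize h24 (hℬ b hb) htx) (by positivity)
    _ = ∑ b ∈ ℬ, (4 : ℝ) ^ b.primeFactors.card * A.congrSum b x +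
          A.congrSum 1 x * ∑ b ∈ ℬ, (4 : ℝ) ^ b.primeFactors.card * A.density b := by
        rw [Finset.mul_sum, ← Finset.sum_add_distrib]
        refine Finset.sum_congr rfl fun b _ => by ring
    _ ≤ _ := add_le_add_left (A.sum_four_pow_mul_congrSum_le ℬ hℬ x) _

/-! ### `ES`: moduli with a large square divisor, reduced to the weighted sums `W_t(ℓ²)` -/

/-- **`ES`, first step**: for a set of primes `L` and squarefree `d ∈ 𝒟`,
`∑_{d ∈ 𝒟} A_{lcm(d, ℓ_L²)}(t) ≤ W_t(ℓ_L²) = ∑_{n ≤ t, ℓ_L² ∣ n} a_n 2^{ω(n)}`. [folklore] -/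
theorem sum_congrSum_lcm_le_weighted (𝒟 : Finset ℕ) (h𝒟 : ∀ d ∈ 𝒟, Squarefree d)
    (L : Finset ℕ) (t : ℝ) :
    ∑ d ∈ 𝒟, A.congrSum (Nat.lcm d ((∏ p ∈ L, p) ^ 2)) t ≤
      ∑ n ∈ (Ioc 0 ⌊t⌋₊).filter ((∏ p ∈ L, p) ^ 2 ∣ ·), A.a n * (2 : ℝ) ^ n.primeFactors.card := by
  simp only [SieveSequence.congrSum, Finset.sum_filter]
  rw [Finset.sum_comm]
  refine Finset.sum_le_sum fun n hn => ?_
  have hn1 := Finset.mem_Ioc.mp hn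
  have hn0 : n ≠ 0 := by omega
  have ha : (0 : ℝ) ≤ A.a n := A.a_nonneg n
  by_cases hl : (∏ p ∈ L, p) ^ 2 ∣ n
  · rw [if_pos hl]
    calc ∑ d ∈ 𝒟, (if Nat.lcm d ((∏ p ∈ L, p) ^ 2) ∣ n then A.a n else 0)
        ≤ ∑ d ∈ 𝒟, (if d ∣ n then A.a n else 0) := by
          refine Finset.sum_le_sum fun d _ => ?_
          by_cases h1 : Nat.lcm d ((∏ p ∈ L, p) ^ 2) ∣ n
          · rw [if_pos h1, if_pos ((Nat.dvd_lcm_left _ _).trans h1)]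
          · rw [if_neg h1]; split_ifs <;> simp [ha]
      _ = #{d ∈ 𝒟 | d ∣ n} * A.a n := by
          rw [← Finset.sum_filter, Finset.sum_const, nsmul_eq_mul]
      _ ≤ (2 : ℝ) ^ n.primeFactors.card * A.a n := by
          refine mul_le_mul_of_nonneg_right ?_ ha
          exact_mod_cast card_filter_dvd_le_two_pow 𝒟 h𝒟 hn0
      _ = A.a n * (2 : ℝ) ^ n.primeFactors.card := mul_comm _ _
  · rw [if_neg hl]
    refine (Finset.sum_eq_zero fun d _ => ?_).le
    rw [if_neg (fun h => hl ((Nat.dvd_lcm_right _ _).trans h))]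

/-- **`ES`, second step**: only `Λ < ℓ_L ≤ √⌊t⌋` contribute, and `L ↦ ℓ_L` is injective:
`∑_{L ⊆ T, ℓ_L > Λ} W_t(ℓ_L²) ≤ ∑_{Λ < ℓ ≤ √⌊t⌋, ℓ sqfree} W_t(ℓ²)`. [folklore] -/
theorem sum_big_weighted_le {T : Finset ℕ} (hT : ∀ p ∈ T, p.Prime) (Λ : ℕ) (t : ℝ) :
    ∑ L ∈ T.powerset with ¬(∏ p ∈ L, p) ≤ Λ,
        ∑ n ∈ (Ioc 0 ⌊t⌋₊).filter ((∏ p ∈ L, p) ^ 2 ∣ ·), A.a n * (2 : ℝ) ^ n.primeFactors.card ≤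
      ∑ l ∈ (Ioc Λ (Nat.sqrt ⌊t⌋₊)).filter Squarefree,
        ∑ n ∈ (Ioc 0 ⌊t⌋₊).filter (l ^ 2 ∣ ·), A.a n * (2 : ℝ) ^ n.primeFactors.card := by
  set X := ⌊t⌋₊ with hX
  set P := T.powerset.filter (fun L => ¬(∏ p ∈ L, p) ≤ Λ) with hP
  set W : ℕ → ℝ := fun m => ∑ n ∈ (Ioc 0 X).filter (m ∣ ·), A.a n * (2 : ℝ) ^ n.primeFactors.card
    with hW
  have hW0 : ∀ m, 0 ≤ W m := fun m => Finset.sum_nonneg fun n _ =>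
    mul_nonneg (A.a_nonneg n) (by positivity)
  have hWzero : ∀ m, X < m → W m = 0 := fun m hm => by
    refine Finset.sum_eq_zero fun n hn => ?_
    exfalso
    have hn' := Finset.mem_filter.mp hn
    have h1 := Finset.mem_Ioc.mp hn'.1
    exact absurd (Nat.le_of_dvd h1.1 hn'.2) (by omega)
  change ∑ L ∈ P, W ((∏ p ∈ L, p) ^ 2) ≤ ∑ l ∈ (Ioc Λ (Nat.sqrt X)).filter Squarefree, W (l ^ 2)
  rw [← Finset.sum_filter_add_sum_filter_not P (fun L => (∏ p ∈ L, p) ^ 2 ≤ X)]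
  have hzero : ∑ L ∈ P with ¬(∏ p ∈ L, p) ^ 2 ≤ X, W ((∏ p ∈ L, p) ^ 2) = 0 :=
    Finset.sum_eq_zero fun L hL => hWzero _ (not_le.mp (Finset.mem_filter.mp hL).2)
  rw [hzero, add_zero]
  have hinj : Set.InjOn (fun L : Finset ℕ => ∏ p ∈ L, p) ↑(P.filter fun L => (∏ p ∈ L, p) ^ 2 ≤ X) := by
    intro L hL L' hL' h
    have hLp : ∀ p ∈ L, p.Prime := fun p hp =>
      hT p (Finset.mem_powerset.mp (Finset.mem_filter.mp (Finset.mem_filter.mp hL).1).1 hp)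
    have hLp' : ∀ p ∈ L', p.Prime := fun p hp =>
      hT p (Finset.mem_powerset.mp (Finset.mem_filter.mp (Finset.mem_filter.mp hL').1).1 hp)
    have := congrArg Nat.primeFactors h
    simp only at this
    rwa [Nat.primeFactors_prod hLp, Nat.primeFactors_prod hLp'] at this
  rw [← Finset.sum_image (f := fun l => W (l ^ 2)) (g := fun L : Finset ℕ => ∏ p ∈ L, p) hinj]
  refine Finset.sum_le_sum_of_subset_of_nonneg ?_ fun l _ _ => hW0 _
  intro l hl
  obtain ⟨L, hL, rfl⟩ := Finset.mem_image.mp hl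
  have hL1 := Finset.mem_filter.mp hL
  have hL2 := Finset.mem_filter.mp hL1.1
  have hLp : ∀ p ∈ L, p.Prime := fun p hp => hT p (Finset.mem_powerset.mp hL2.1 hp)
  refine Finset.mem_filter.mpr ⟨Finset.mem_Ioc.mpr ⟨not_le.mp hL2.2, Nat.le_sqrt'.mpr hL1.2⟩,
    squarefree_prod_of_primes hLp⟩

/-- **`ES` summed over `d`, reduced to the weighted sums**: for squarefree `d ∈ 𝒟`,
`∑_{d ∈ 𝒟} ∑_{L ⊆ T, ℓ_L > Λ} A_{lcm(d, ℓ_L²)}(t) ≤ ∑_{Λ < ℓ ≤ √⌊t⌋, ℓ sqfree} W_t(ℓ²)`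
(FI's `E₂ ≤ ∑_n a_n τ(n) #{ν : ν² ∣ n, ν > L}`, p. 1062, with `2^{ω}` for `τ`).
[cite: FriedlanderIwaniecASP1998, §9 p. 1062] -/
theorem sum_sum_big_congrSum_lcm_le {T : Finset ℕ} (hT : ∀ p ∈ T, p.Prime) (Λ : ℕ) (t : ℝ)
    (𝒟 : Finset ℕ) (h𝒟 : ∀ d ∈ 𝒟, Squarefree d) :
    ∑ d ∈ 𝒟, ∑ L ∈ T.powerset with ¬(∏ p ∈ L, p) ≤ Λ, A.congrSum (Nat.lcm d ((∏ p ∈ L, p) ^ 2)) t ≤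
      ∑ l ∈ (Ioc Λ (Nat.sqrt ⌊t⌋₊)).filter Squarefree,
        ∑ n ∈ (Ioc 0 ⌊t⌋₊).filter (l ^ 2 ∣ ·), A.a n * (2 : ℝ) ^ n.primeFactors.card := by
  rw [Finset.sum_comm]
  exact (Finset.sum_le_sum fun L _ => A.sum_congrSum_lcm_le_weighted 𝒟 h𝒟 L t).trans
    (A.sum_big_weighted_le hT Λ t)

/-! ### Swapping and reindexing helpers -/

omit A in
/-- `∑_{ℓ ∈ S} ∑_{n ≤ X, q(ℓ) ∣ n} f(n) = ∑_{n ≤ X} f(n) · #{ℓ ∈ S : q(ℓ) ∣ n}`. [folklore] -/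
theorem sum_sum_filter_dvd_eq (S : Finset ℕ) (q : ℕ → ℕ) (X : ℕ) (f : ℕ → ℝ) :
    ∑ l ∈ S, ∑ n ∈ (Ioc 0 X).filter (q l ∣ ·), f n =
      ∑ n ∈ Ioc 0 X, f n * #{l ∈ S | q l ∣ n} := by
  simp only [Finset.sum_filter]
  rw [Finset.sum_comm]
  refine Finset.sum_congr rfl fun n _ => ?_
  rw [Finset.card_filter, Nat.cast_sum, Finset.mul_sum]
  refine Finset.sum_congr rfl fun l _ => ?_
  split_ifs <;> simp

omit A in
/-- Reindexing the multiples: `∑_{n ≤ X, q ∣ n} f(n) = ∑_{m ≤ X/q} f(q m)` for `q ≥ 1`. [folklore] -/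
theorem sum_filter_dvd_eq_sum_div {q : ℕ} (hq : 0 < q) (X : ℕ) (f : ℕ → ℝ) :
    ∑ n ∈ (Ioc 0 X).filter (q ∣ ·), f n = ∑ m ∈ Ioc 0 (X / q), f (q * m) := by
  have hinj : Set.InjOn (fun m => q * m) ↑(Ioc 0 (X / q)) := fun a _ b _ h =>
    Nat.eq_of_mul_eq_mul_left hq h
  rw [← Finset.sum_image (f := f) hinj]
  refine Finset.sum_congr ?_ fun _ _ => rfl
  ext n
  simp only [Finset.mem_filter, Finset.mem_Ioc, Finset.mem_image]
  constructor
  · rintro ⟨⟨hn0, hnX⟩, ⟨m, rfl⟩⟩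
    refine ⟨m, ⟨Nat.pos_of_ne_zero (by rintro rfl; simp at hn0), ?_⟩, rfl⟩
    exact (Nat.le_div_iff_mul_le hq).mpr (by rw [mul_comm]; exact hnX)
  · rintro ⟨m, ⟨hm0, hmX⟩, rfl⟩
    refine ⟨⟨Nat.mul_pos hq hm0, ?_⟩, dvd_mul_right q m⟩
    calc q * m ≤ q * (X / q) := Nat.mul_le_mul_left q hmX
      _ ≤ X := Nat.mul_div_le X q

/-! ### `ES` on `ℓ > Λ₁`: Cauchy–Schwarz with (2.2) and divisor sums (FI's `E₂₁`) -/

/-- **`E₂₁`, Cauchy–Schwarz**: with `S` a set of squarefree numbers and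
`c(n) = #{ℓ ∈ S : ℓ² ∣ n}` (`≤ 2^{ω(n)}`),
`(∑_{ℓ ∈ S} W_t(ℓ²))² ≤ (∑_{n ≤ t} a_n²) · ∑_{n ≤ t} 8^{ω(n)} c(n)`
(FI p. 1062: `E₂₁ ≤ (∑ a_n²)^{1/2} (∑ τ(n)³ ∑_{ν²∣n, ν>L√D} 1)^{1/2}`). [cite: FriedlanderIwaniecASP1998, §9 p. 1062] -/
theorem sq_sum_weighted_le_sum_sq_mul (S : Finset ℕ) (hS : ∀ l ∈ S, Squarefree l) (t : ℝ) :
    (∑ l ∈ S, ∑ n ∈ (Ioc 0 ⌊t⌋₊).filter (l ^ 2 ∣ ·), A.a n * (2 : ℝ) ^ n.primeFactors.card) ^ 2 ≤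
      (∑ n ∈ Ioc 0 ⌊t⌋₊, A.a n ^ 2) *
        ∑ n ∈ Ioc 0 ⌊t⌋₊, (8 : ℝ) ^ n.primeFactors.card * #{l ∈ S | l ^ 2 ∣ n} := by
  set X := ⌊t⌋₊ with hX
  rw [sum_sum_filter_dvd_eq S (fun l => l ^ 2) X]
  have hc : ∀ n ∈ Ioc 0 X, (#{l ∈ S | l ^ 2 ∣ n} : ℝ) ≤ (2 : ℝ) ^ n.primeFactors.card := by
    intro n hn
    have hn0 : n ≠ 0 := (Finset.mem_Ioc.mp hn).1.ne'
    calc (#{l ∈ S | l ^ 2 ∣ n} : ℝ) ≤ (#{l ∈ S | l ∣ n} : ℝ) := by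
          exact_mod_cast Finset.card_le_card fun l hl => by
            simp only [Finset.mem_filter] at hl ⊢
            exact ⟨hl.1, (dvd_pow_self l two_ne_zero).trans hl.2⟩
      _ ≤ (2 : ℝ) ^ n.primeFactors.card := by exact_mod_cast card_filter_dvd_le_two_pow S hS hn0
  calc (∑ n ∈ Ioc 0 X, A.a n * (2 : ℝ) ^ n.primeFactors.card * #{l ∈ S | l ^ 2 ∣ n}) ^ 2
      = (∑ n ∈ Ioc 0 X, A.a n * ((2 : ℝ) ^ n.primeFactors.card * #{l ∈ S | l ^ 2 ∣ n})) ^ 2 := by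
        congr 1; exact Finset.sum_congr rfl fun n _ => by ring
    _ ≤ (∑ n ∈ Ioc 0 X, A.a n ^ 2) *
          ∑ n ∈ Ioc 0 X, ((2 : ℝ) ^ n.primeFactors.card * #{l ∈ S | l ^ 2 ∣ n}) ^ 2 :=
        Finset.sum_mul_sq_le_sq_mul_sq _ _ _
    _ ≤ (∑ n ∈ Ioc 0 X, A.a n ^ 2) *
          ∑ n ∈ Ioc 0 X, (8 : ℝ) ^ n.primeFactors.card * #{l ∈ S | l ^ 2 ∣ n} := by
        refine mul_le_mul_of_nonneg_left (Finset.sum_le_sum fun n hn => ?_)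
          (Finset.sum_nonneg fun n _ => sq_nonneg _)
        have h0 : (0 : ℝ) ≤ #{l ∈ S | l ^ 2 ∣ n} := Nat.cast_nonneg _
        calc ((2 : ℝ) ^ n.primeFactors.card * #{l ∈ S | l ^ 2 ∣ n}) ^ 2
            = (4 : ℝ) ^ n.primeFactors.card * #{l ∈ S | l ^ 2 ∣ n} * #{l ∈ S | l ^ 2 ∣ n} := by
              rw [mul_pow, ← pow_mul, show (4 : ℝ) = 2 ^ 2 by norm_num, ← pow_mul]; ring
          _ ≤ (4 : ℝ) ^ n.primeFactors.card * #{l ∈ S | l ^ 2 ∣ n} * (2 : ℝ) ^ n.primeFactors.card :=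
              mul_le_mul_of_nonneg_left (hc n hn) (by positivity)
          _ = (8 : ℝ) ^ n.primeFactors.card * #{l ∈ S | l ^ 2 ∣ n} := by
              rw [show (8 : ℝ) = 4 * 2 by norm_num, mul_pow]; ring

omit A in
/-- **`E₂₁`, the divisor sum**: for `S = {Λ₁ < ℓ ≤ √X, ℓ sqfree}` with `Λ₁ ≥ 1` and
`V ≥ ∑_{m ≤ X} τ(m)³/m`: `∑_{n ≤ X} 8^{ω(n)} #{ℓ ∈ S : ℓ² ∣ n} ≤ X V²/Λ₁`
(`n = ℓ²m`, `8^{ω(n)} ≤ 8^{ω(ℓ)} 8^{ω(m)}`, `8^{ω} ≤ τ³`, `∑_{m≤X/ℓ²} τ(m)³ ≤ (X/ℓ²) V`,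
`∑_{ℓ>Λ₁} τ(ℓ)³/ℓ² ≤ V/Λ₁`). [cite: FriedlanderIwaniecASP1998, §9 p. 1062] -/
theorem sum_eight_pow_mul_card_le {X Λ₁ : ℕ} (hΛ₁ : 1 ≤ Λ₁) {V : ℝ}
    (hV : ∑ m ∈ Icc 1 X, (σ 0 m : ℝ) ^ 3 / m ≤ V) :
    ∑ n ∈ Ioc 0 X, (8 : ℝ) ^ n.primeFactors.card *
        #{l ∈ (Ioc Λ₁ (Nat.sqrt X)).filter Squarefree | l ^ 2 ∣ n} ≤ X * V ^ 2 / Λ₁ := by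
  set S := (Ioc Λ₁ (Nat.sqrt X)).filter Squarefree with hS
  have hV0 : 0 ≤ V := le_trans (Finset.sum_nonneg fun m _ => by positivity) hV
  have h8τ : ∀ m : ℕ, m ≠ 0 → (8 : ℝ) ^ m.primeFactors.card ≤ (σ 0 m : ℝ) ^ 3 := fun m hm => by
    rw [show (8 : ℝ) = 2 ^ 3 by norm_num, ← pow_mul, mul_comm, pow_mul]
    exact pow_le_pow_left₀ (by positivity) (two_pow_card_primeFactors_le_sigma m hm) 3
  -- partial sums of `τ³` against `V`
  have hτ3 : ∀ N : ℕ, N ≤ X → ∑ m ∈ Ioc 0 N, (σ 0 m : ℝ) ^ 3 ≤ N * V := by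
    intro N hN
    calc ∑ m ∈ Ioc 0 N, (σ 0 m : ℝ) ^ 3 ≤ ∑ m ∈ Ioc 0 N, (N : ℝ) * ((σ 0 m : ℝ) ^ 3 / m) := by
          refine Finset.sum_le_sum fun m hm => ?_
          have hm' := Finset.mem_Ioc.mp hm
          have hm0 : (0 : ℝ) < m := by exact_mod_cast hm'.1
          rw [mul_div_assoc', le_div_iff₀ hm0, mul_comm]
          exact mul_le_mul_of_nonneg_right (by exact_mod_cast hm'.2) (by positivity)
      _ = (N : ℝ) * ∑ m ∈ Ioc 0 N, (σ 0 m : ℝ) ^ 3 / m := (Finset.mul_sum _ _ _).symm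
      _ ≤ (N : ℝ) * V := by
          refine mul_le_mul_of_nonneg_left (le_trans ?_ hV) (Nat.cast_nonneg N)
          refine Finset.sum_le_sum_of_subset_of_nonneg (fun m hm => ?_) fun m _ _ => by positivity
          have hm' := Finset.mem_Ioc.mp hm
          exact Finset.mem_Icc.mpr ⟨hm'.1, hm'.2.trans hN⟩
  -- swap back to `ℓ` and reindex `n = ℓ² m`
  rw [← sum_sum_filter_dvd_eq S (fun l => l ^ 2) X (fun n => (8 : ℝ) ^ n.primeFactors.card)]
  have hl : ∀ l ∈ S, Squarefree l ∧ Λ₁ < l ∧ l ≤ Nat.sqrt X := fun l hl => by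
    have h := Finset.mem_filter.mp hl
    exact ⟨h.2, (Finset.mem_Ioc.mp h.1).1, (Finset.mem_Ioc.mp h.1).2⟩
  have hstep : ∀ l ∈ S, ∑ n ∈ (Ioc 0 X).filter (l ^ 2 ∣ ·), (8 : ℝ) ^ n.primeFactors.card ≤
      (σ 0 l : ℝ) ^ 3 * ((X : ℝ) / (l : ℝ) ^ 2 * V) := by
    intro l hlS
    obtain ⟨hsq, hΛl, -⟩ := hl l hlS
    have hl0 : l ≠ 0 := hsq.ne_zero
    have hl2 : 0 < l ^ 2 := pow_pos (Nat.pos_of_ne_zero hl0) 2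
    rw [sum_filter_dvd_eq_sum_div hl2]
    calc ∑ m ∈ Ioc 0 (X / l ^ 2), (8 : ℝ) ^ (l ^ 2 * m).primeFactors.card
        ≤ ∑ m ∈ Ioc 0 (X / l ^ 2), (8 : ℝ) ^ l.primeFactors.card * (σ 0 m : ℝ) ^ 3 := by
          refine Finset.sum_le_sum fun m hm => ?_
          have hm0 : m ≠ 0 := (Finset.mem_Ioc.mp hm).1.ne'
          calc (8 : ℝ) ^ (l ^ 2 * m).primeFactors.card
              ≤ (8 : ℝ) ^ (l.primeFactors.card + m.primeFactors.card) := by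
                refine pow_le_pow_right₀ (by norm_num) ?_
                rw [Nat.primeFactors_mul (pow_ne_zero 2 hl0) hm0, Nat.primeFactors_pow l two_ne_zero]
                exact Finset.card_union_le _ _
            _ = (8 : ℝ) ^ l.primeFactors.card * (8 : ℝ) ^ m.primeFactors.card := pow_add _ _ _
            _ ≤ (8 : ℝ) ^ l.primeFactors.card * (σ 0 m : ℝ) ^ 3 :=
                mul_le_mul_of_nonneg_left (h8τ m hm0) (by positivity)
      _ = (8 : ℝ) ^ l.primeFactors.card * ∑ m ∈ Ioc 0 (X / l ^ 2), (σ 0 m : ℝ) ^ 3 :=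
          (Finset.mul_sum _ _ _).symm
      _ ≤ (σ 0 l : ℝ) ^ 3 * (((X / l ^ 2 : ℕ) : ℝ) * V) :=
          mul_le_mul (h8τ l hl0) (hτ3 _ (Nat.div_le_self _ _))
            (Finset.sum_nonneg fun m _ => by positivity) (by positivity)
      _ ≤ (σ 0 l : ℝ) ^ 3 * ((X : ℝ) / (l : ℝ) ^ 2 * V) := by
          refine mul_le_mul_of_nonneg_left (mul_le_mul_of_nonneg_right ?_ hV0) (by positivity)
          have := Nat.cast_div_le (m := X) (n := l ^ 2) (α := ℝ)
          simpa using this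
  calc ∑ l ∈ S, ∑ n ∈ (Ioc 0 X).filter (l ^ 2 ∣ ·), (8 : ℝ) ^ n.primeFactors.card
      ≤ ∑ l ∈ S, (σ 0 l : ℝ) ^ 3 * ((X : ℝ) / (l : ℝ) ^ 2 * V) := Finset.sum_le_sum hstep
    _ ≤ ∑ l ∈ S, (X : ℝ) * V / Λ₁ * ((σ 0 l : ℝ) ^ 3 / l) := by
        refine Finset.sum_le_sum fun l hlS => ?_
        obtain ⟨hsq, hΛl, -⟩ := hl l hlS
        have hl0 : (0 : ℝ) < l := by exact_mod_cast Nat.pos_of_ne_zero hsq.ne_zero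
        have hΛ0 : (0 : ℝ) < Λ₁ := by exact_mod_cast hΛ₁
        have hΛl' : (Λ₁ : ℝ) ≤ l := by exact_mod_cast hΛl.le
        rw [show (σ 0 l : ℝ) ^ 3 * ((X : ℝ) / (l : ℝ) ^ 2 * V) =
          (X : ℝ) * V / l * ((σ 0 l : ℝ) ^ 3 / l) by field_simp]
        refine mul_le_mul_of_nonneg_right ?_ (by positivity)
        exact div_le_div_of_nonneg_left (by positivity) hΛ0 hΛl'
    _ = (X : ℝ) * V / Λ₁ * ∑ l ∈ S, (σ 0 l : ℝ) ^ 3 / l := (Finset.mul_sum _ _ _).symm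
    _ ≤ (X : ℝ) * V / Λ₁ * V := by
        refine mul_le_mul_of_nonneg_left (le_trans ?_ hV) (by positivity)
        refine Finset.sum_le_sum_of_subset_of_nonneg (fun l hlS => ?_) fun l _ _ => by positivity
        obtain ⟨hsq, hΛl, hlX⟩ := hl l hlS
        refine Finset.mem_Icc.mpr ⟨Nat.one_le_iff_ne_zero.mpr hsq.ne_zero, hlX.trans (Nat.sqrt_le_self X)⟩
    _ = X * V ^ 2 / Λ₁ := by ring

/-! ### `ES` on `Λ < ℓ ≤ Λ₁`: Cauchy–Schwarz against `S₁ = ∑ A_{ℓ²}(x)` (FI's `E₂₂`) -/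

/-- **`E₂₂`, Cauchy–Schwarz** (FI p. 1062: "`E₂₂² ≤ (∑♭_{L<ν≤L√D} A_{ν²}(x))(∑ a_n τ(n)³) = S₁S₂`",
with `2^{ω}` for `τ`): for a set `S` of squarefree numbers,
`(∑_{ℓ ∈ S} W_x(ℓ²))² ≤ (∑_{ℓ ∈ S} A_{ℓ²}(x)) · ∑_{n ≤ x} a_n 2^{3ω(n)}`.
[cite: FriedlanderIwaniecASP1998, §9 p. 1062] -/
theorem sq_sum_weighted_le_sum_congrSum_mul (S : Finset ℕ) (hS : ∀ l ∈ S, Squarefree l) (x : ℝ) :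
    (∑ l ∈ S, ∑ n ∈ (Ioc 0 ⌊x⌋₊).filter (l ^ 2 ∣ ·), A.a n * (2 : ℝ) ^ n.primeFactors.card) ^ 2 ≤
      (∑ l ∈ S, A.congrSum (l ^ 2) x) *
        ∑ n ∈ Ioc 0 ⌊x⌋₊, A.a n * (2 : ℝ) ^ (3 * n.primeFactors.card) := by
  set X := ⌊x⌋₊ with hX
  set F : ℕ → Finset ℕ := fun l => (Ioc 0 X).filter (l ^ 2 ∣ ·) with hF
  -- the double sum as a sum over the sigma finset
  have e1 : ∑ l ∈ S, ∑ n ∈ F l, A.a n * (2 : ℝ) ^ n.primeFactors.card =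
      ∑ q ∈ S.sigma F, A.a q.2 * (2 : ℝ) ^ q.2.primeFactors.card :=
    (Finset.sum_sigma S F fun q => A.a q.2 * (2 : ℝ) ^ q.2.primeFactors.card).symm
  have e2 : ∑ l ∈ S, A.congrSum (l ^ 2) x = ∑ q ∈ S.sigma F, A.a q.2 :=
    (Finset.sum_sigma S F fun q => A.a q.2).symm
  have e3 : ∑ q ∈ S.sigma F, A.a q.2 * (4 : ℝ) ^ q.2.primeFactors.card =
      ∑ l ∈ S, ∑ n ∈ F l, A.a n * (4 : ℝ) ^ n.primeFactors.card :=
    Finset.sum_sigma S F fun q => A.a q.2 * (4 : ℝ) ^ q.2.primeFactors.card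
  change (∑ l ∈ S, ∑ n ∈ F l, A.a n * (2 : ℝ) ^ n.primeFactors.card) ^ 2 ≤
    (∑ l ∈ S, A.congrSum (l ^ 2) x) * ∑ n ∈ Ioc 0 X, A.a n * (2 : ℝ) ^ (3 * n.primeFactors.card)
  rw [e1, e2]
  have hCS := Finset.sum_sq_le_sum_mul_sum_of_sq_le_mul (S.sigma F)
    (r := fun q => A.a q.2 * (2 : ℝ) ^ q.2.primeFactors.card) (f := fun q => A.a q.2)
    (g := fun q => A.a q.2 * (4 : ℝ) ^ q.2.primeFactors.card)
    (fun q _ => A.a_nonneg _) (fun q _ => mul_nonneg (A.a_nonneg _) (by positivity))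
    (fun q _ => le_of_eq (by
      rw [mul_pow, ← pow_mul, show (4 : ℝ) = 2 ^ 2 by norm_num, ← pow_mul]; ring))
  refine hCS.trans (mul_le_mul_of_nonneg_left ?_ (Finset.sum_nonneg fun q _ => A.a_nonneg _))
  rw [e3, sum_sum_filter_dvd_eq S (fun l => l ^ 2) X]
  refine Finset.sum_le_sum fun n hn => ?_
  have hn0 : n ≠ 0 := (Finset.mem_Ioc.mp hn).1.ne'
  have hc : (#{l ∈ S | l ^ 2 ∣ n} : ℝ) ≤ (2 : ℝ) ^ n.primeFactors.card := by
    calc (#{l ∈ S | l ^ 2 ∣ n} : ℝ) ≤ (#{l ∈ S | l ∣ n} : ℝ) := by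
          exact_mod_cast Finset.card_le_card fun l hl => by
            simp only [Finset.mem_filter] at hl ⊢
            exact ⟨hl.1, (dvd_pow_self l two_ne_zero).trans hl.2⟩
      _ ≤ (2 : ℝ) ^ n.primeFactors.card := by exact_mod_cast card_filter_dvd_le_two_pow S hS hn0
  calc A.a n * (4 : ℝ) ^ n.primeFactors.card * #{l ∈ S | l ^ 2 ∣ n}
      ≤ A.a n * (4 : ℝ) ^ n.primeFactors.card * (2 : ℝ) ^ n.primeFactors.card :=
        mul_le_mul_of_nonneg_left hc (mul_nonneg (A.a_nonneg _) (by positivity))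
    _ = A.a n * (2 : ℝ) ^ (3 * n.primeFactors.card) := by
        rw [show (4 : ℝ) = 2 ^ 2 by norm_num, ← pow_mul, mul_assoc, ← pow_add]; ring_nf

/-- **`S₁` by Rankin's trick with exponent `3/4` and the level hypothesis** (FI p. 1062:
"`S₁ = ∑♭ (g(ν²)A(x) + r_{ν²}(x)) ≪ A(x)L⁻¹(log L)^B` by (1.8), (9.1), and (R₃)"): for `1 ≤ Λ`,
`Λ₁² ≤ M`, under (2.4) and (2.6) `g(p²) ≤ K/p²`,
`∑_{Λ<ℓ≤Λ₁ sqfree} A_{ℓ²}(x) ≤ A_1(x) · exp(K ∑_n n^{-5/4}) / Λ^{3/4} + ∑_{b ≤ M cubefree} |r_b(x)|`.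
[cite: FriedlanderIwaniecASP1998, §9 p. 1062] -/
theorem sum_mid_congrSum_sq_le_rankin (hsize : ∀ t, A.size t = A.congrSum 1 t)
    (h24 : ∀ p : ℕ, p.Prime → 0 ≤ A.density (p ^ 2) ∧ A.density (p ^ 2) ≤ A.density p ∧
      A.density p < 1)
    {K : ℝ} (h26 : ∀ p : ℕ, p.Prime → A.density (p ^ 2) ≤ K / (p : ℝ) ^ 2)
    {Λ Λ₁ M : ℕ} (hΛ : 1 ≤ Λ) (hM : Λ₁ ^ 2 ≤ M) (x : ℝ) :
    ∑ l ∈ (Ioc Λ Λ₁).filter Squarefree, A.congrSum (l ^ 2) x ≤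
      A.congrSum 1 x * (Real.exp (K * ∑' n : ℕ, (n : ℝ) ^ (-(5 / 4 : ℝ))) / (Λ : ℝ) ^ (3 / 4 : ℝ)) +
        ∑ b ∈ (Icc 1 M).filter IsCubefree, |A.remainder b x| := by
  set g := A.density with hg
  have hgm : g.IsMultiplicative := A.density_mult
  set S := (Ioc Λ Λ₁).filter Squarefree with hS
  have hA := A.congrSum_nonneg 1 x
  have hK := hyp26_const_nonneg h24 h26
  have hsum : Summable (fun n : ℕ => (n : ℝ) ^ (-(5 / 4 : ℝ))) :=
    Real.summable_nat_rpow.mpr (by norm_num)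
  set C := ∑' n : ℕ, (n : ℝ) ^ (-(5 / 4 : ℝ)) with hC
  have hl : ∀ l ∈ S, Squarefree l ∧ Λ < l ∧ l ≤ Λ₁ := fun l hl => by
    have h := Finset.mem_filter.mp hl
    exact ⟨h.2, (Finset.mem_Ioc.mp h.1).1, (Finset.mem_Ioc.mp h.1).2⟩
  -- `A_{ℓ²}(x) = g(ℓ²) A_1(x) + r_{ℓ²}(x)`
  have hdec : ∀ l ∈ S, A.congrSum (l ^ 2) x ≤ A.congrSum 1 x * g (l ^ 2) + |A.remainder (l ^ 2) x| := by
    intro l _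
    have : A.congrSum (l ^ 2) x = g (l ^ 2) * A.congrSum 1 x + A.remainder (l ^ 2) x := by
      rw [SieveSequence.remainder, hsize x]; ring
    rw [this, mul_comm]
    linarith [le_abs_self (A.remainder (l ^ 2) x)]
  refine (Finset.sum_le_sum hdec).trans ?_
  rw [Finset.sum_add_distrib, ← Finset.mul_sum]
  refine add_le_add (mul_le_mul_of_nonneg_left ?_ hA) ?_
  · -- Rankin with exponent `3/4`
    have hΛ0 : (0 : ℝ) < Λ := by exact_mod_cast hΛ
    have hΛr : 0 < (Λ : ℝ) ^ (3 / 4 : ℝ) := Real.rpow_pos_of_pos hΛ0 _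
    have hg2 : ∀ l ∈ S, g (l ^ 2) = ∏ p ∈ l.primeFactors, g (p ^ 2) := fun l hlS => by
      obtain ⟨hsq, -, -⟩ := hl l hlS
      conv_lhs => rw [← Nat.prod_primeFactors_of_squarefree hsq, ← Finset.prod_pow]
      exact hgm.map_prod (fun p => p ^ 2) _ fun p hp q hq hpq =>
        Nat.coprime_pow_primes 2 2 (Nat.prime_of_mem_primeFactors hp) (Nat.prime_of_mem_primeFactors hq) hpq
    have hg2nn : ∀ l ∈ S, 0 ≤ g (l ^ 2) := fun l hlS => by
      rw [hg2 l hlS]; exact Finset.prod_nonneg fun p hp => (h24 p (Nat.prime_of_mem_primeFactors hp)).1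
    -- insert `(ℓ/Λ)^{3/4} ≥ 1`
    have h1 : ∑ l ∈ S, g (l ^ 2) ≤ ∑ l ∈ S, (∏ p ∈ l.primeFactors, ((p : ℝ) ^ (3 / 4 : ℝ) * g (p ^ 2))) /
        (Λ : ℝ) ^ (3 / 4 : ℝ) := by
      refine Finset.sum_le_sum fun l hlS => ?_
      obtain ⟨hsq, hΛl, -⟩ := hl l hlS
      rw [Finset.prod_mul_distrib, ← hg2 l hlS, le_div_iff₀ hΛr,
        Real.finsetProd_rpow _ _ (fun p _ => Nat.cast_nonneg p), ← Nat.cast_prod,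
        Nat.prod_primeFactors_of_squarefree hsq]
      refine mul_comm (g (l ^ 2)) _ ▸ mul_le_mul_of_nonneg_left
        (Real.rpow_le_rpow (Nat.cast_nonneg _) (by exact_mod_cast hΛl.le) (by norm_num)) (hg2nn l hlS)
    refine h1.trans ?_
    rw [← Finset.sum_div]
    refine div_le_div_of_nonneg_right ?_ hΛr.le
    -- extend to all squarefree `ℓ ≤ Λ₁` and take the Euler product
    have hf0 : ∀ p : ℕ, p.Prime → 0 ≤ (p : ℝ) ^ (3 / 4 : ℝ) * g (p ^ 2) := fun p hp =>
      mul_nonneg (by positivity) (h24 p hp).1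
    calc ∑ l ∈ S, ∏ p ∈ l.primeFactors, ((p : ℝ) ^ (3 / 4 : ℝ) * g (p ^ 2))
        ≤ ∑ l ∈ (Icc 1 Λ₁).filter Squarefree, ∏ p ∈ l.primeFactors, ((p : ℝ) ^ (3 / 4 : ℝ) * g (p ^ 2)) := by
          refine Finset.sum_le_sum_of_subset_of_nonneg (fun l hlS => ?_) fun l _ _ =>
            Finset.prod_nonneg fun p hp => hf0 p (Nat.prime_of_mem_primeFactors hp)
          obtain ⟨hsq, hΛl, hlΛ₁⟩ := hl l hlS
          exact Finset.mem_filter.mpr ⟨Finset.mem_Icc.mpr ⟨by omega, hlΛ₁⟩, hsq⟩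
      _ ≤ ∏ p ∈ Nat.primesLE Λ₁, (1 + (p : ℝ) ^ (3 / 4 : ℝ) * g (p ^ 2)) :=
          sum_squarefree_prod_primeFactors_le hf0 Λ₁
      _ ≤ Real.exp (∑ p ∈ Nat.primesLE Λ₁, (p : ℝ) ^ (3 / 4 : ℝ) * g (p ^ 2)) :=
          prod_one_add_le_exp_sum _ fun p hp => hf0 p (Nat.prime_of_mem_primesLE hp)
      _ ≤ Real.exp (K * C) := by
          refine Real.exp_le_exp.mpr ?_
          calc ∑ p ∈ Nat.primesLE Λ₁, (p : ℝ) ^ (3 / 4 : ℝ) * g (p ^ 2)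
              ≤ ∑ p ∈ Nat.primesLE Λ₁, K * (p : ℝ) ^ (-(5 / 4 : ℝ)) := by
                refine Finset.sum_le_sum fun p hp => ?_
                have hp' := Nat.prime_of_mem_primesLE hp
                have hp0 : (0 : ℝ) < p := by exact_mod_cast hp'.pos
                calc (p : ℝ) ^ (3 / 4 : ℝ) * g (p ^ 2) ≤ (p : ℝ) ^ (3 / 4 : ℝ) * (K / (p : ℝ) ^ 2) :=
                      mul_le_mul_of_nonneg_left (h26 p hp') (by positivity)
                  _ = K * (p : ℝ) ^ (-(5 / 4 : ℝ)) := by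
                      rw [show (-(5 / 4 : ℝ)) = 3 / 4 - 2 by norm_num, Real.rpow_sub hp0,
                        Real.rpow_two]; ring
            _ = K * ∑ p ∈ Nat.primesLE Λ₁, (p : ℝ) ^ (-(5 / 4 : ℝ)) := (Finset.mul_sum _ _ _).symm
            _ ≤ K * C := mul_le_mul_of_nonneg_left
                (hsum.sum_le_tsum _ fun n _ => by positivity) hK
  · -- the remainders: `ℓ ↦ ℓ²` injects `S` into the cubefree `b ≤ M`
    have hinj : Set.InjOn (fun l : ℕ => l ^ 2) ↑S := fun a _ b _ h => by
      simpa using (Nat.pow_left_injective two_ne_zero) h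
    rw [← Finset.sum_image (f := fun b => |A.remainder b x|) hinj]
    refine Finset.sum_le_sum_of_subset_of_nonneg (fun b hb => ?_) fun b _ _ => abs_nonneg _
    obtain ⟨l, hlS, rfl⟩ := Finset.mem_image.mp hb
    obtain ⟨hsq, hΛl, hlΛ₁⟩ := hl l hlS
    refine Finset.mem_filter.mpr ⟨Finset.mem_Icc.mpr ⟨Nat.one_le_pow _ _ (by omega), ?_⟩, ?_⟩
    · exact (Nat.pow_le_pow_left hlΛ₁ 2).trans hM
    · intro p hp
      rw [Nat.factorization_pow, Finsupp.smul_apply, smul_eq_mul]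
      have := hsq.natFactorization_le_one p
      omega

/-! ### `TG`: the density tail, Rankin's trick with exponent `3/4` -/

/-- **Summing the density tail over `d`**: for a set of primes `L` and the squarefree `d ≤ D₀`,
`∑_d g(lcm(d, ℓ_L²)) ≤ 2^{|L|} (∏_{p∈L} g(p²)) ∑_{d' ≤ D₀ sqfree} g(d')`
(`d ↦ (∏_{p∣d, p∉L} p, primeFactors d ∩ L)` is injective). [folklore] -/
theorem sum_density_lcm_sq_le
    (h24 : ∀ p : ℕ, p.Prime → 0 ≤ A.density (p ^ 2) ∧ A.density (p ^ 2) ≤ A.density p ∧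
      A.density p < 1)
    (D₀ : ℕ) {L : Finset ℕ} (hL : ∀ p ∈ L, p.Prime) :
    ∑ d ∈ (Icc 1 D₀).filter Squarefree, A.density (Nat.lcm d ((∏ p ∈ L, p) ^ 2)) ≤
      2 ^ #L * (∏ p ∈ L, A.density (p ^ 2)) *
        ∑ d ∈ (Icc 1 D₀).filter Squarefree, A.density d := by
  set g := A.density with hg
  have hgm : g.IsMultiplicative := A.density_mult
  set 𝒟 := (Icc 1 D₀).filter Squarefree with h𝒟
  set ψ : ℕ → ℕ × Finset ℕ := fun d => (∏ p ∈ d.primeFactors \ L, p, d.primeFactors ∩ L) with hψ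
  set G : ℕ × Finset ℕ → ℝ := fun y => g y.1 * ∏ p ∈ L, g (p ^ 2) with hG
  have hsq : ∀ d ∈ 𝒟, Squarefree d := fun d hd => (Finset.mem_filter.mp hd).2
  have h1 : ∑ d ∈ 𝒟, g (Nat.lcm d ((∏ p ∈ L, p) ^ 2)) = ∑ d ∈ 𝒟, G (ψ d) := by
    refine Finset.sum_congr rfl fun d hd => ?_
    rw [density_lcm_sq' hgm (hsq d hd) hL]
  have hinj : Set.InjOn ψ 𝒟 := by
    intro d hd d' hd' h
    simp only [hψ, Prod.mk.injEq] at h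
    obtain ⟨h1, h2⟩ := h
    have hpf : d.primeFactors = d'.primeFactors := by
      have e1 : d.primeFactors = (d.primeFactors \ L) ∪ (d.primeFactors ∩ L) :=
        (Finset.sdiff_union_inter _ _).symm
      have e2 : d'.primeFactors = (d'.primeFactors \ L) ∪ (d'.primeFactors ∩ L) :=
        (Finset.sdiff_union_inter _ _).symm
      have e3 : d.primeFactors \ L = d'.primeFactors \ L := by
        have := congrArg Nat.primeFactors h1
        rwa [Nat.primeFactors_prod (fun p hp => Nat.prime_of_mem_primeFactors (Finset.mem_sdiff.mp hp).1),
          Nat.primeFactors_prod (fun p hp => Nat.prime_of_mem_primeFactors (Finset.mem_sdiff.mp hp).1)]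
          at this
      rw [e1, e2, e3, h2]
    rw [← Nat.prod_primeFactors_of_squarefree (hsq d hd),
      ← Nat.prod_primeFactors_of_squarefree (hsq d' hd'), hpf]
  have himg : 𝒟.image ψ ⊆ 𝒟 ×ˢ L.powerset := by
    intro y hy
    obtain ⟨d, hd, rfl⟩ := Finset.mem_image.mp hy
    have hdsq := hsq d hd
    have hd1 := (Finset.mem_Icc.mp (Finset.mem_filter.mp hd).1)
    simp only [hψ, Finset.mem_product, Finset.mem_powerset, Finset.inter_subset_right, and_true]
    refine Finset.mem_filter.mpr ⟨Finset.mem_Icc.mpr ⟨?_, ?_⟩, ?_⟩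
    · exact Finset.prod_pos fun p hp => (Nat.prime_of_mem_primeFactors (Finset.mem_sdiff.mp hp).1).pos
    · refine le_trans (Nat.le_of_dvd (by omega) ?_) hd1.2
      calc ∏ p ∈ d.primeFactors \ L, p ∣ ∏ p ∈ d.primeFactors, p :=
            Finset.prod_dvd_prod_of_subset _ _ _ Finset.sdiff_subset
        _ = d := Nat.prod_primeFactors_of_squarefree hdsq
    · exact squarefree_prod_of_primes fun p hp => Nat.prime_of_mem_primeFactors (Finset.mem_sdiff.mp hp).1
  have hGnn : ∀ y ∈ 𝒟 ×ˢ L.powerset, 0 ≤ G y := by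
    intro y hy
    have hy1 := (Finset.mem_product.mp hy).1
    exact mul_nonneg (density_squarefree_nonneg hgm h24 (hsq _ hy1))
      (Finset.prod_nonneg fun p hp => (h24 p (hL p hp)).1)
  rw [h1, ← Finset.sum_image hinj]
  refine (Finset.sum_le_sum_of_subset_of_nonneg himg fun y hy _ => hGnn y hy).trans ?_
  rw [Finset.sum_product, Finset.sum_comm]
  simp only [hG, Finset.sum_const, Finset.card_powerset, nsmul_eq_mul, Finset.mul_sum]
  refine le_of_eq (Finset.sum_congr rfl fun d _ => ?_)
  push_cast; ring

/-- **Rankin's trick for the density tail, exponent `3/4`**: under (2.4) and (2.6),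
`∑_{L ⊆ T, ℓ_L > Λ} 2^{|L|} ∏_{p∈L} g(p²) ≤ Λ^{-3/4} ∏_{p ∈ T} (1 + 2 p^{3/4} g(p²))
≤ exp(2K ∑_n n^{-5/4}) Λ^{-3/4}` for any finite set of primes `T` and `Λ ≥ 1`. [folklore] -/
theorem sum_big_two_pow_mul_prod_le_rankin
    (h24 : ∀ p : ℕ, p.Prime → 0 ≤ A.density (p ^ 2) ∧ A.density (p ^ 2) ≤ A.density p ∧
      A.density p < 1)
    {K : ℝ} (h26 : ∀ p : ℕ, p.Prime → A.density (p ^ 2) ≤ K / (p : ℝ) ^ 2)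
    {T : Finset ℕ} (hT : ∀ p ∈ T, p.Prime) {Λ : ℕ} (hΛ : 1 ≤ Λ) :
    ∑ L ∈ T.powerset with ¬(∏ p ∈ L, p) ≤ Λ, (2 : ℝ) ^ #L * ∏ p ∈ L, A.density (p ^ 2) ≤
      Real.exp (2 * K * ∑' n : ℕ, (n : ℝ) ^ (-(5 / 4 : ℝ))) / (Λ : ℝ) ^ (3 / 4 : ℝ) := by
  set g := A.density with hg
  have hK := hyp26_const_nonneg h24 h26
  have hsum : Summable (fun n : ℕ => (n : ℝ) ^ (-(5 / 4 : ℝ))) :=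
    Real.summable_nat_rpow.mpr (by norm_num)
  have hΛ0 : (0 : ℝ) < Λ := by exact_mod_cast hΛ
  have hΛr : 0 < (Λ : ℝ) ^ (3 / 4 : ℝ) := Real.rpow_pos_of_pos hΛ0 _
  -- Rankin: insert the factor `ℓ_L^{3/4} / Λ^{3/4} ≥ 1`
  have h1 : ∑ L ∈ T.powerset with ¬(∏ p ∈ L, p) ≤ Λ, (2 : ℝ) ^ #L * ∏ p ∈ L, g (p ^ 2) ≤
      ∑ L ∈ T.powerset with ¬(∏ p ∈ L, p) ≤ Λ,
        (∏ p ∈ L, (2 * (p : ℝ) ^ (3 / 4 : ℝ) * g (p ^ 2))) / (Λ : ℝ) ^ (3 / 4 : ℝ) := by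
    refine Finset.sum_le_sum fun L hL => ?_
    have hL' := Finset.mem_filter.mp hL
    have hLp : ∀ p ∈ L, p.Prime := fun p hp => hT p (Finset.mem_powerset.mp hL'.1 hp)
    have hbig : (Λ : ℝ) ≤ (∏ p ∈ L, p : ℕ) := by exact_mod_cast (not_le.mp hL'.2).le
    have hprod : ∏ p ∈ L, (2 * (p : ℝ) ^ (3 / 4 : ℝ) * g (p ^ 2)) =
        (2 : ℝ) ^ #L * (∏ p ∈ L, g (p ^ 2)) * ((∏ p ∈ L, p : ℕ) : ℝ) ^ (3 / 4 : ℝ) := by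
      rw [Nat.cast_prod, ← Real.finsetProd_rpow _ _ (fun p _ => Nat.cast_nonneg p),
        Finset.prod_mul_distrib, Finset.prod_mul_distrib, Finset.prod_const]
      ring
    rw [hprod, le_div_iff₀ hΛr]
    have hnn : 0 ≤ (2 : ℝ) ^ #L * ∏ p ∈ L, g (p ^ 2) :=
      mul_nonneg (by positivity) (Finset.prod_nonneg fun p hp => (h24 p (hLp p hp)).1)
    exact mul_le_mul_of_nonneg_left (Real.rpow_le_rpow hΛ0.le hbig (by norm_num)) hnn
  refine h1.trans ?_
  rw [← Finset.sum_div]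
  refine div_le_div_of_nonneg_right ?_ hΛr.le
  have hnn : ∀ L ∈ T.powerset, 0 ≤ ∏ p ∈ L, (2 * (p : ℝ) ^ (3 / 4 : ℝ) * g (p ^ 2)) := by
    intro L hL
    exact Finset.prod_nonneg fun p hp =>
      mul_nonneg (by positivity) (h24 p (hT p (Finset.mem_powerset.mp hL hp))).1
  calc ∑ L ∈ T.powerset with ¬(∏ p ∈ L, p) ≤ Λ, ∏ p ∈ L, (2 * (p : ℝ) ^ (3 / 4 : ℝ) * g (p ^ 2))
      ≤ ∑ L ∈ T.powerset, ∏ p ∈ L, (2 * (p : ℝ) ^ (3 / 4 : ℝ) * g (p ^ 2)) :=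
        Finset.sum_le_sum_of_subset_of_nonneg (Finset.filter_subset _ _) fun L hL _ => hnn L hL
    _ = ∏ p ∈ T, (1 + 2 * (p : ℝ) ^ (3 / 4 : ℝ) * g (p ^ 2)) := (Finset.prod_one_add T).symm
    _ ≤ Real.exp (∑ p ∈ T, 2 * (p : ℝ) ^ (3 / 4 : ℝ) * g (p ^ 2)) :=
        prod_one_add_le_exp_sum _ fun p hp => mul_nonneg (by positivity) (h24 p (hT p hp)).1
    _ ≤ Real.exp (2 * K * ∑' n : ℕ, (n : ℝ) ^ (-(5 / 4 : ℝ))) := by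
        refine Real.exp_le_exp.mpr ?_
        calc ∑ p ∈ T, 2 * (p : ℝ) ^ (3 / 4 : ℝ) * g (p ^ 2)
            ≤ ∑ p ∈ T, 2 * K * (p : ℝ) ^ (-(5 / 4 : ℝ)) := by
              refine Finset.sum_le_sum fun p hp => ?_
              have hp' := hT p hp
              have hp0 : (0 : ℝ) < p := by exact_mod_cast hp'.pos
              calc 2 * (p : ℝ) ^ (3 / 4 : ℝ) * g (p ^ 2) ≤ 2 * (p : ℝ) ^ (3 / 4 : ℝ) * (K / (p : ℝ) ^ 2) :=
                    mul_le_mul_of_nonneg_left (h26 p hp') (by positivity)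
                _ = 2 * K * (p : ℝ) ^ (-(5 / 4 : ℝ)) := by
                    rw [show (-(5 / 4 : ℝ)) = 3 / 4 - 2 by norm_num, Real.rpow_sub hp0, Real.rpow_two]
                    ring
          _ = 2 * K * ∑ p ∈ T, (p : ℝ) ^ (-(5 / 4 : ℝ)) := (Finset.mul_sum _ _ _).symm
          _ ≤ 2 * K * ∑' n : ℕ, (n : ℝ) ^ (-(5 / 4 : ℝ)) :=
              mul_le_mul_of_nonneg_left (hsum.sum_le_tsum T fun n _ => by positivity) (by linarith)

/-- **The density tail summed over `d`**:
`∑_{d ≤ D₀ sqfree} ∑_{L ⊆ T, ℓ_L > Λ} g(lcm(d, ℓ_L²)) ≤ exp(2K C) Λ^{-3/4} ∑_{d ≤ D₀ sqfree} g(d)`,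
`C = ∑_n n^{-5/4}`. [folklore] -/
theorem sum_sum_big_density_lcm_le
    (h24 : ∀ p : ℕ, p.Prime → 0 ≤ A.density (p ^ 2) ∧ A.density (p ^ 2) ≤ A.density p ∧
      A.density p < 1)
    {K : ℝ} (h26 : ∀ p : ℕ, p.Prime → A.density (p ^ 2) ≤ K / (p : ℝ) ^ 2)
    {T : Finset ℕ} (hT : ∀ p ∈ T, p.Prime) {Λ : ℕ} (hΛ : 1 ≤ Λ) (D₀ : ℕ) :
    ∑ d ∈ (Icc 1 D₀).filter Squarefree, ∑ L ∈ T.powerset with ¬(∏ p ∈ L, p) ≤ Λ,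
        A.density (Nat.lcm d ((∏ p ∈ L, p) ^ 2)) ≤
      Real.exp (2 * K * ∑' n : ℕ, (n : ℝ) ^ (-(5 / 4 : ℝ))) / (Λ : ℝ) ^ (3 / 4 : ℝ) *
        ∑ d ∈ (Icc 1 D₀).filter Squarefree, A.density d := by
  rw [Finset.sum_comm]
  have hG : 0 ≤ ∑ d ∈ (Icc 1 D₀).filter Squarefree, A.density d :=
    Finset.sum_nonneg fun d hd => density_squarefree_nonneg A.density_mult h24 (Finset.mem_filter.mp hd).2
  calc ∑ L ∈ T.powerset with ¬(∏ p ∈ L, p) ≤ Λ, ∑ d ∈ (Icc 1 D₀).filter Squarefree,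
        A.density (Nat.lcm d ((∏ p ∈ L, p) ^ 2))
      ≤ ∑ L ∈ T.powerset with ¬(∏ p ∈ L, p) ≤ Λ, (2 ^ #L * (∏ p ∈ L, A.density (p ^ 2)) *
          ∑ d ∈ (Icc 1 D₀).filter Squarefree, A.density d) :=
        Finset.sum_le_sum fun L hL => A.sum_density_lcm_sq_le h24 D₀
          fun p hp => hT p (Finset.mem_powerset.mp (Finset.mem_filter.mp hL).1 hp)
    _ = (∑ L ∈ T.powerset with ¬(∏ p ∈ L, p) ≤ Λ, (2 : ℝ) ^ #L * ∏ p ∈ L, A.density (p ^ 2)) *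
          ∑ d ∈ (Icc 1 D₀).filter Squarefree, A.density d := by rw [Finset.sum_mul]
    _ ≤ _ := mul_le_mul_of_nonneg_right (A.sum_big_two_pow_mul_prod_le_rankin h24 h26 hT hΛ) hG

/-- `∑_{d ≤ D₀ sqfree} g(d) ≤ exp(∑_{p ≤ D₀} g(p))` under (2.4). [folklore] -/
theorem sum_squarefree_density_le_exp
    (h24 : ∀ p : ℕ, p.Prime → 0 ≤ A.density (p ^ 2) ∧ A.density (p ^ 2) ≤ A.density p ∧
      A.density p < 1) (D₀ : ℕ) :
    ∑ d ∈ (Icc 1 D₀).filter Squarefree, A.density d ≤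
      Real.exp (∑ p ∈ Nat.primesLE D₀, A.density p) := by
  have hg0 : ∀ p : ℕ, p.Prime → 0 ≤ A.density p := fun p hp => (h24 p hp).1.trans (h24 p hp).2.1
  have h1 : ∑ d ∈ (Icc 1 D₀).filter Squarefree, A.density d =
      ∑ d ∈ (Icc 1 D₀).filter Squarefree, ∏ p ∈ d.primeFactors, A.density p :=
    Finset.sum_congr rfl fun d hd => (A.density_mult.prod_primeFactors (Finset.mem_filter.mp hd).2).symm
  rw [h1]
  exact (sum_squarefree_prod_primeFactors_le hg0 D₀).trans
    (prod_one_add_le_exp_sum _ fun p hp => hg0 p (Nat.prime_of_mem_primesLE hp))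

/-- `∑_{d ≤ D₀ sqfree} g̃(d) ≤ ∑_{d ≤ D₀ sqfree} g(d)` under (2.4). [folklore] -/
theorem sum_squarefree_moebiusSqDensity_le
    (h24 : ∀ p : ℕ, p.Prime → 0 ≤ A.density (p ^ 2) ∧ A.density (p ^ 2) ≤ A.density p ∧
      A.density p < 1) (D₀ : ℕ) :
    ∑ d ∈ (Icc 1 D₀).filter Squarefree, moebiusSqDensity A.density d ≤
      ∑ d ∈ (Icc 1 D₀).filter Squarefree, A.density d :=
  Finset.sum_le_sum fun _ hd =>
    (moebiusSqDensity_squarefree_nonneg_le A.density_mult h24 (Finset.mem_filter.mp hd).2).2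

end SieveSequence

end Literature.NumberTheory.Sieve
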